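import Literature.MathematicalPhysics.QuantumFieldTheory.Balaban1983to89.B8Ineq159CurvedCubeMemberPerCube
import Literature.MathematicalPhysics.QuantumFieldTheory.Balaban1983to89.B9Ineq3137LocalSup
import Literature.MathematicalPhysics.QuantumFieldTheory.Balaban1983to89.B8Ineq130

/-!
# `Balaban1983to89.B8Ineq159CurvedCubeMemberLocal` — [Balaban1985RegularSpaces] (1.59) p. 86 AT A CURVED BACKGROUND ON THE CUBE MEMBER, PER MEMBER,
# truncation `m = 1`, WITH THE BACKGROUND CONSTRAINED ONLY NEAR THE MEMBER: locality of the (1.59) data in the background ([Balaban1985Averaging] p. 24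
# «this definition is local», [Balaban1985BackgroundPropagators] (3.19), (3.23)) — the current, the Landau stencil of (1.38), the truncation-`1` transpose
# and the level-`≤ 1` averages at the member read `U₀` on the box `□₀ + (L + 3)` only — so file (D)'s bondwise closeness is needed THERE only
# (file (F) of the per-member curved (1.59))

statement-level skeleton of published theorems with citation tags; proofs where landed; nothing here is a claim about the
Yang–Mills mass gap

`[Balaban1985RegularSpaces]` ("B8", CMP **99** (1985) 75–102) (1.1)–(1.2) p. 76, (1.29) p. 81, (1.31) p. 82, (1.38) p. 82, (1.55) p. 86, (1.59) p. 86,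
(1.131) p. 99; [4] = `[Balaban1985BackgroundPropagators]` (CMP **99** (1985) 389–434) (3.19) p. 393, (3.23)–(3.25) p. 394; [B7] = `[Balaban1985Averaging]`
(CMP **98** (1985) 17–51) p. 24 (after (43)) «this definition is local in the sense that Ū^k_c depends only on the bond variables U_b for b ⊂ B^k(c₋) ∪
B^k(c₊)», (78)–(80) p. 30, (127) p. 37.

CITATION HEADER (lean-in-tree rule).  Cell `pub-ymgap` (YM Track A, HUMAN RULING D-0062 ∕ D-0149), DAG node N05 = [B8], width seat `pub-ymgap-dag-n05-w3`
(g2), CLAIM-1 file (F).  WHY.  File (D) asks `‖U₀(b) − 1‖ ≤ δ₀` on ALL bonds of `ℤᵈ`; the sockets' `𝔄_k(α₀)` constrains `U₀` only on the plaquettes of the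
domain tower, and print's Lemma 1 gives an axial gauge on a BOX.  THIS FILE localises: every datum and every target of the member's (1.59) at truncation `1`
reads `U₀` only on bonds based in `[sqLo₀ − (L+3), sqHi₀ + (L+3)]` (`□₀ = [sqLo₀, sqHi₀]`); replacing `U₀` by `1` off that box changes nothing, and file (D)
applies to the modified background.  With file (E) (gauge covariance) and `B8Lemma1NonAbelian.axial_bond_bound_sharp` (Lemma 1's axial gauge on a box) this
is the per-member (1.59) for backgrounds with small PLAQUETTES on a box around `□₀` — the composition is left to the consumer (HONEST SCOPE).

THE MATHEMATICS (kernel-checked).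
* §1 background-locality of the stencils: `D^η_{U₀,μ}f(x)` reads `U₀(x, μ)`; `D^{η*}_{U₀,ν}f(x)` reads `U₀(x − e_ν, ν)`; the plaquette derivative at `x` reads
  `U₀(x, ·)`; ★ the current `J_{U₀}(A)_μ(x)` and the Laplacian `Δ^η_{U₀}g(x)` read `U₀` on bonds based in the ℓ∞-unit ball of `x`; ★ the Landau stencil
  `Δ^η_{U₀}(𝟙_SD^{η*}_{U₀}A)(x)` on the ball of radius `2`; ★ the truncation-`1` transpose `(Q′(U₀)ᵀμ)(x)` on the `L`-block of `x` ([B7] (78)–(80): the block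
  transporter `U₀(Γ_{Ly,x})`; `B8Ineq130.axialFn_congr`); the level-`≤ 1` averages by `B9Ineq3137LocalSup.linCovIter_congr` (p. 24) BY NAME.
* §2 ★★★ `exists_curved159_perCube_truncOne_local` — file (D)'s statement with `‖U₀(b) − 1‖ ≤ δ₀` asked ONLY for bonds based in
  `[sqLo₀ − (L+3), sqHi₀ + (L+3)]` (same `δ₀(□), B′(□)`; extra side condition `L ≤ ρ`, print's collar width, for the class bonds' boxes
  `B8Ineq159FlatCubeMemberPrinted.cubeLamBP_box_subset_pred`).

HONEST SCOPE.  Locality bookkeeping + file (D); per member, non-explicit constants, truncation `m = 1`; the box `□₀ + (L+3)` sticks OUT of `□₀ = Ω₀` by `L + 3`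
sites, where `𝔄_k(α₀)` of the cube member says nothing — so even composed with (E) + Lemma 1 the hypothesis is «small plaquettes on `□₀ + (L+3)`», a
neighbourhood version of print's class, NOT `InAk` verbatim; NOT a socket inhabitant; NOT [4] Thm 3.3; count-neutral; N05 NOT discharged; no count claim; one
finite `𝕋⁴` programme at fixed `ε`, Bałaban as printed; the YM mass gap (Clay) is NOT proved by any of this — R4 closes the conditional finite-`𝕋⁴` rung
`BalabanLadder.UV` only; nothing continuum ∕ ℝ⁴ ∕ OS.  No `sorry`, no `def`, no `instance`, no `notation`.  Unit `pub-ymgap-dag-n05-w3` (g2), 2026-08-28.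
-/

noncomputable section

namespace Literature.MathematicalPhysics.QuantumFieldTheory.Balaban1983to89.B8Ineq159CurvedCubeMemberLocal

open B7Prop1Explicit B7Prop2Explicit B7Prop1Local
open B7Eq78Linearization (conjR conjR_apply)
open B7Prop4GeneralLevels (linCovIter)
open B8Ineq132 (covDerivFwd covDeriv BondTouches)
open B8Eq140Level (SideTouches)
open B8Eq143PlaqExpansion (pdiv)
open B8Eq146AExpansion (iEta plaqCovDeriv plaqCovDeriv_eq_covDerivFwd)
open B8Eq155JBound (Jcur)
open B8Eq138LandauZd (IsLandau138 covLap covDivB qprimeT1 QprimeT QT)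
open B8Eq119TwistedAxial (bgT)
open B8Eq131Cubes (cube sqLo sqHi cube_anti)
open B8Eq131CubesAdmissible (cubeFam cubeFam_false_zero cubeFam_false_of_le)
open B8CubeMemberZd (cubeLamS)
open B8Ineq159FlatCubeMemberPrinted (cubeLamBP cubeLamBP_box_subset_pred cubeLamBP_zero_bondTouches)
open B8Ineq159FlatCubeMemberPerCube (inBox_pred_of_bondTouches inBox_widen_of_sideTouches)
open B8Ineq159FlatCubeMemberKernel (mem_cube_zero_iff)
open B8Ineq159CurvedCubeMemberPerCube (exists_curved159_perCube_truncOne)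
open B9Ineq3137LocalSup (linCovIter_congr)
open B8Ineq130 (axialFn_congr)
open Literature.MathematicalPhysics.QuantumLattice (blockMap blockBase)

export B7Prop1Explicit (Site)

variable {d : ℕ} {𝔸 : Type*} [NormedRing 𝔸] [NormOneClass 𝔸] [NormedAlgebra ℂ 𝔸] [CompleteSpace 𝔸]

/-! ## §1 Background-locality of the stencils -/

section Locality

variable {η : ℝ} {U₀ U₀' : Site d → Fin d → 𝔸ˣ}

omit [NormOneClass 𝔸] [CompleteSpace 𝔸] in
/-- `D^η_{U₀,μ}f(x)` reads the background at the bond `(x, μ)` only. [cite: Balaban1985RegularSpaces, (1.1) p.76] -/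
theorem covDerivFwd_congr_bg (μ : Fin d) (f : Site d → 𝔸) (x : Site d) (h : U₀ x μ = U₀' x μ) :
    covDerivFwd η U₀ μ f x = covDerivFwd η U₀' μ f x := by
  simp only [covDerivFwd, h]

omit [NormOneClass 𝔸] [CompleteSpace 𝔸] in
/-- `D^{η*}_{U₀,ν}f(x)` reads the background at the bond `(x − e_ν, ν)` only. [cite: Balaban1985RegularSpaces, (1.1) p.76] -/
theorem covDeriv_congr_bg (ν : Fin d) (f : Site d → 𝔸) (x : Site d) (h : U₀ (x - e ν) ν = U₀' (x - e ν) ν) :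
    covDeriv η U₀ ν f x = covDeriv η U₀' ν f x := by
  simp only [covDeriv, h]

omit [NormOneClass 𝔸] [CompleteSpace 𝔸] in
/-- The plaquette derivative (3.4) at `x` reads the background at the bonds based at `x` only. [cite: Balaban1985BackgroundPropagators, (3.4) p.391] -/
theorem plaqCovDeriv_congr_bg (A : Site d → Fin d → 𝔸) (μ ν : Fin d) (x : Site d) (h : ∀ κ, U₀ x κ = U₀' x κ) :
    plaqCovDeriv η U₀ A μ ν x = plaqCovDeriv η U₀' A μ ν x := by
  rw [plaqCovDeriv_eq_covDerivFwd, plaqCovDeriv_eq_covDerivFwd, covDerivFwd_congr_bg μ _ x (h μ), covDerivFwd_congr_bg ν _ x (h ν)]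

omit [NormOneClass 𝔸] [CompleteSpace 𝔸] in
/-- ★ **The current (1.55) reads the background on the ℓ∞-unit ball**: `J_{U₀}(A)_μ(x)` depends on `U₀(y, κ)` only for `|y − x|∞ ≤ 1`.
[cite: Balaban1985RegularSpaces, (1.55) p.86, (1.1)–(1.2) p.76] -/
theorem Jcur_congr_bg (A : Site d → Fin d → 𝔸) (μ : Fin d) (x : Site d)
    (h : ∀ (y : Site d) (κ : Fin d), (∀ i, x i - 1 ≤ y i ∧ y i ≤ x i + 1) → U₀ y κ = U₀' y κ) :
    Jcur η U₀ A μ x = Jcur η U₀' A μ x := by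
  have hx : ∀ κ, U₀ x κ = U₀' x κ := fun κ => h x κ fun i => ⟨by linarith, by linarith⟩
  have hm : ∀ ν κ, U₀ (x - e ν) κ = U₀' (x - e ν) κ := fun ν κ => h _ κ fun i => by
    rw [Pi.sub_apply, e_apply]; split_ifs <;> constructor <;> linarith
  have hP : ∀ ν κ κ', plaqCovDeriv η U₀ A κ κ' (x - e ν) = plaqCovDeriv η U₀' A κ κ' (x - e ν) :=
    fun ν κ κ' => plaqCovDeriv_congr_bg A κ κ' _ (hm ν)
  have hP0 : ∀ κ κ', plaqCovDeriv η U₀ A κ κ' x = plaqCovDeriv η U₀' A κ κ' x := fun κ κ' => plaqCovDeriv_congr_bg A κ κ' x hx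
  rw [B8Eq155JBound.Jcur_def, B8Eq155JBound.Jcur_def]
  unfold pdiv
  congr 1
  · refine Finset.sum_congr rfl fun ν _ => ?_
    simp only [covDeriv, hm ν ν, hP, hP0]
  · refine Finset.sum_congr rfl fun ν _ => ?_
    simp only [covDeriv, hm ν ν, hP, hP0]

omit [NormOneClass 𝔸] [CompleteSpace 𝔸] in
/-- **The divergence `D^{η*}_{U₀}A(x)` reads the background at the bonds `(x − e_ν, ν)`.** [cite: Balaban1985RegularSpaces, (1.38) p.82, (1.1) p.76] -/
theorem covDivB_congr_bg (A : Site d → Fin d → 𝔸) (x : Site d) (h : ∀ ν, U₀ (x - e ν) ν = U₀' (x - e ν) ν) :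
    covDivB η U₀ A x = covDivB η U₀' A x := by
  unfold covDivB
  exact Finset.sum_congr rfl fun ν _ => covDeriv_congr_bg ν _ x (h ν)

omit [NormOneClass 𝔸] [CompleteSpace 𝔸] in
/-- ★ **The Laplacian (3.23) reads the background on the ℓ∞-unit ball**: `Δ^η_{U₀}g(x)` depends on `U₀(y, κ)` only for `|y − x|∞ ≤ 1`.
[cite: Balaban1985BackgroundPropagators, (3.23) p.394] -/
theorem covLap_congr_bg (g : Site d → 𝔸) (x : Site d)
    (h : ∀ (y : Site d) (κ : Fin d), (∀ i, x i - 1 ≤ y i ∧ y i ≤ x i + 1) → U₀ y κ = U₀' y κ) :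
    covLap η U₀ g x = covLap η U₀' g x := by
  have hx : ∀ κ, U₀ x κ = U₀' x κ := fun κ => h x κ fun i => ⟨by linarith, by linarith⟩
  have hm : ∀ ν κ, U₀ (x - e ν) κ = U₀' (x - e ν) κ := fun ν κ => h _ κ fun i => by
    rw [Pi.sub_apply, e_apply]; split_ifs <;> constructor <;> linarith
  have hG : ∀ ν, covDerivFwd η U₀ ν g (x - e ν) = covDerivFwd η U₀' ν g (x - e ν) := fun ν => covDerivFwd_congr_bg ν g _ (hm ν ν)
  have hG0 : ∀ ν, covDerivFwd η U₀ ν g x = covDerivFwd η U₀' ν g x := fun ν => covDerivFwd_congr_bg ν g x (hx ν)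
  unfold covLap covDivB
  refine Finset.sum_congr rfl fun ν _ => ?_
  simp only [covDeriv, hm ν ν, hG, hG0]

omit [NormOneClass 𝔸] [CompleteSpace 𝔸] in
/-- **Field-locality of the Laplacian** (fixed background): `Δ^η_Vf(x)` reads `f` on the ℓ∞-unit ball of `x` (the general-normed-algebra twin of
`B9SupplySockB9P3ZdLettersOmega.covLap_congr_ball`). [cite: Balaban1985BackgroundPropagators, (3.23) p.394] -/
theorem covLap_congr_fun {V : Site d → Fin d → 𝔸ˣ} {f g : Site d → 𝔸} {x : Site d}
    (h : ∀ y : Site d, (∀ i, x i - 1 ≤ y i ∧ y i ≤ x i + 1) → f y = g y) : covLap η V f x = covLap η V g x := by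
  have hx : f x = g x := h x fun i => ⟨by linarith, by linarith⟩
  have hp : ∀ ν : Fin d, f (x + e ν) = g (x + e ν) := fun ν => h _ fun i => by
    rw [Pi.add_apply, e_apply]; split_ifs <;> constructor <;> linarith
  have hm : ∀ ν : Fin d, f (x - e ν) = g (x - e ν) := fun ν => h _ fun i => by
    rw [Pi.sub_apply, e_apply]; split_ifs <;> constructor <;> linarith
  have hmp : ∀ ν : Fin d, f (x - e ν + e ν) = g (x - e ν + e ν) := fun ν => by rw [sub_add_cancel]; exact hx
  unfold covLap covDivB
  refine Finset.sum_congr rfl fun ν _ => ?_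
  simp only [covDeriv, covDerivFwd, hx, hp, hm, hmp]

omit [NormOneClass 𝔸] [CompleteSpace 𝔸] in
/-- ★ **The Landau stencil of (1.38) reads the background on the ball of radius `2`**: `Δ^η_{U₀}(𝟙_SD^{η*}_{U₀}A)(x)` depends on `U₀(y, κ)` only for
`|y − x|∞ ≤ 2`. [cite: Balaban1985RegularSpaces, (1.38) p.82; Balaban1985BackgroundPropagators, (3.23)–(3.25) p.394] -/
theorem landauStencil_congr_bg (S : Set (Site d)) (A : Site d → Fin d → 𝔸) (x : Site d)
    (h : ∀ (y : Site d) (κ : Fin d), (∀ i, x i - 2 ≤ y i ∧ y i ≤ x i + 2) → U₀ y κ = U₀' y κ) :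
    covLap η U₀ (S.indicator (covDivB η U₀ A)) x = covLap η U₀' (S.indicator (covDivB η U₀' A)) x := by
  classical
  have h1 : covLap η U₀ (S.indicator (covDivB η U₀ A)) x = covLap η U₀' (S.indicator (covDivB η U₀ A)) x :=
    covLap_congr_bg _ x fun y κ hy => h y κ fun i => ⟨by linarith [(hy i).1], by linarith [(hy i).2]⟩
  rw [h1]
  refine covLap_congr_fun fun y hy => ?_
  by_cases hyS : y ∈ S
  · rw [Set.indicator_of_mem hyS, Set.indicator_of_mem hyS]
    refine covDivB_congr_bg A y fun ν => h _ ν fun i => ?_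
    have := hy i
    rw [Pi.sub_apply, e_apply]; split_ifs <;> constructor <;> linarith [this.1, this.2]
  · rw [Set.indicator_of_notMem hyS, Set.indicator_of_notMem hyS]

/-- The `L`-block of `x` is the box `[Ly(x), Ly(x) + (L − 1)𝟙]` and contains `x`. [cite: Balaban1985Averaging, (43) p.24] -/
theorem inBox_blockBase_blockMap {L : ℕ} (hL : 1 ≤ L) (x : Site d) :
    InBox (blockBase L (blockMap L x)) (blockBase L (blockMap L x) + ((L : ℤ) - 1) • (1 : Site d)) x := by
  have hL0 : (0 : ℤ) < L := by exact_mod_cast hL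
  intro i
  simp only [blockBase, blockMap, Pi.add_apply, Pi.smul_apply, Pi.one_apply, smul_eq_mul, mul_one]
  have h0 : 0 ≤ x i % (L : ℤ) := Int.emod_nonneg _ hL0.ne'
  have h1 : x i % (L : ℤ) < L := Int.emod_lt_of_pos _ hL0
  have h2 : x i % (L : ℤ) = x i - (L : ℤ) * (x i / (L : ℤ)) := Int.emod_def _ _
  constructor <;> omega

omit [NormOneClass 𝔸] in
/-- **The level-`0` block transporter reads the background on the `L`-block of `x`** ([B7] (78)–(80); `B8Ineq130.axialFn_congr`): if `U₀`, `U₀′` agree on the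
bonds of the box `[x − (L−1)𝟙, x + (L−1)𝟙]` then `U₀(Γ_{Ly,x}) = U₀′(Γ_{Ly,x})`. [cite: Balaban1985Averaging, (78)–(80) p.30, p.24; Balaban1985RegularSpaces, (1.29) p.81] -/
theorem bgT_zero_congr_bg {L : ℕ} (hL : 1 ≤ L) (x : Site d)
    (h : AgreeOn (x - ((L : ℤ) - 1) • (1 : Site d)) (x + ((L : ℤ) - 1) • (1 : Site d)) U₀ U₀') :
    bgT L U₀ 0 (blockMap L x) x = bgT L U₀' 0 (blockMap L x) x := by
  unfold bgT
  rw [avgIter_zero, avgIter_zero]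
  have hbox := inBox_blockBase_blockMap hL x
  have hsub : AgreeOn (blockBase L (blockMap L x)) (blockBase L (blockMap L x) + ((L : ℤ) - 1) • (1 : Site d)) U₀ U₀' := by
    refine h.mono (fun i => ?_) (fun i => ?_)
    · have := hbox i
      simp only [Pi.sub_apply, Pi.add_apply, Pi.smul_apply, Pi.one_apply, smul_eq_mul, mul_one] at this ⊢
      omega
    · have := hbox i
      simp only [Pi.add_apply, Pi.smul_apply, Pi.one_apply, smul_eq_mul, mul_one] at this ⊢
      omega
  exact axialFn_congr hsub _ x (fun i => by
    have := hbox i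
    simp only [Pi.add_apply, Pi.smul_apply, Pi.one_apply, smul_eq_mul, mul_one] at this ⊢
    have hL1 : (1 : ℤ) ≤ L := by exact_mod_cast hL
    constructor <;> nlinarith) hbox

omit [NormOneClass 𝔸] in
/-- ★ **THE TRUNCATION-`1` TRANSPOSE READS THE BACKGROUND ON THE `L`-BLOCK OF `x`**: `(Q′(U₀)ᵀμ)(x)` at truncation `m = 1` depends on `U₀` only through the
level-`0` block transporter `U₀(Γ_{Ly(x),x})`. [cite: Balaban1985BackgroundPropagators, (3.19) p.393, (3.24) p.394; Balaban1985RegularSpaces, (1.29) p.81, (1.38) p.82] -/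
theorem QT_one_congr_bg {L : ℕ} (hL : 1 ≤ L) (Λs : ℕ → Set (Site d)) (μ : ℕ → Site d → 𝔸) (x : Site d)
    (h : AgreeOn (x - ((L : ℤ) - 1) • (1 : Site d)) (x + ((L : ℤ) - 1) • (1 : Site d)) U₀ U₀') :
    QT L 1 Λs U₀ μ x = QT L 1 Λs U₀' μ x := by
  have hQT : ∀ V : Site d → Fin d → 𝔸ˣ, QT L 1 Λs V μ x = (Λs 0).indicator (μ 0) x + qprimeT1 L V 0 ((Λs 1).indicator (μ 1)) x := by
    intro V
    simp only [QT, Finset.sum_range_succ, Finset.sum_range_zero, zero_add]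
    rfl
  rw [hQT, hQT]
  unfold qprimeT1
  rw [bgT_zero_congr_bg hL x h]

end Locality

/-! ## §2 The per-member curved (1.59) with the background constrained near the member only -/

set_option maxHeartbeats 400000 in
-- one long transfer proof (the modified background and eight locality read-backs); twice the default budget, no heavy automation
/-- ★★★ **(1.59) AT A CURVED BACKGROUND ON THE CUBE MEMBER, PER MEMBER, TRUNCATION `m = 1`, BACKGROUND CONSTRAINED ON `□₀ + (L+3)` ONLY.**  With the SAME
`δ₀(□) > 0`, `B′(□) > 0` as `B8Ineq159CurvedCubeMemberPerCube.exists_curved159_perCube_truncOne`, and the collar side condition `L ≤ ρ`: for every `U1`-valued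
background `U₀` with `‖U₀(y, κ) − 1‖ ≤ δ₀` for the bonds BASED IN THE BOX `[sqLo₀ − (L+3), sqHi₀ + (L+3)]` (no condition elsewhere), every `𝔸`-valued `φ` in
the CURVED Landau gauge of `U₀` at truncation `1` supported on the side-touching bonds of `□₀ ∕ □₁`, and every `N ≥ 0` bounding (i) `(Lʲη)³|J_{U₀}φ|` on the
bonds of `□_j`, (ii) `|Lʲη·Q_j(U₀)(iηφ)|` on print's class, (iii) `η|φ|` on the outer layer: `(Lʲη)|φ|, (Lʲη)²|D^η_{U₀,ν}φ_τ|, (Lʲη)³|Δ^η_{U₀}φ_τ| ≤ B′N` on the sides of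
`□_j` (`j ≤ 1`).  PROOF: the background `U₀′ = U₀` on the box, `= 1` off it, is `δ₀`-close to `1` on all of `ℤᵈ`; by §1 and `linCovIter_congr` every hypothesis
and every target of file (D) for `(U₀′, φ)` equals the corresponding one for `(U₀, φ)` (the Landau stencil and the transpose at `x ∈ □₀` read the ball of radius
`2` ∕ the `L`-block of `x`; the current and the targets on touching ∕ side-touching bonds read radius-`1` balls of `[sqLo₀ − 2, sqHi₀ + 1]`; the class bonds'
boxes lie in `□₀` (`j = 1`, `cubeLamBP_box_subset_pred`) or are the bond itself (`j = 0`)); file (D) at `U₀′`.  HONEST SCOPE: per member, non-explicit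
constants, `m = 1`; the box is a NEIGHBOURHOOD of `Ω₀ = □₀` (sticks out by `L + 3`), NOT print's `𝔄_k(α₀)`; NOT a socket inhabitant; NOT [4] Thm 3.3.
[cite: Balaban1985RegularSpaces, (1.59) p.86, (1.62) p.87, (1.38) p.82, (1.131) p.99; Balaban1985Averaging, p.24 (after (43)), (78)–(80) p.30; Balaban1985BackgroundPropagators, (3.19) p.393, (3.23)–(3.25) p.394, Thm 3.3 p.399] -/
theorem exists_curved159_perCube_truncOne_local [FiniteDimensional ℂ 𝔸] (hd2 : 2 ≤ d) {L : ℕ} (hL : 1 ≤ L) {η : ℝ} (hη : 0 < η)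
    (a : Site d) (M : ℕ) {ρ : ℕ} (hρ : L ≤ ρ) {k : ℕ} (hk : 1 ≤ k) :
    ∃ δ₀ B' : ℝ, 0 < δ₀ ∧ 0 < B' ∧ ∀ (U₀ : Site d → Fin d → 𝔸ˣ), (∀ x κ, U₀ x κ ∈ U1 𝔸) →
      (∀ (x : Site d) (κ : Fin d),
          InBox (sqLo L a ρ k 0 - ((L : ℤ) + 3) • (1 : Site d)) (sqHi L a M ρ k 0 + ((L : ℤ) + 3) • (1 : Site d)) x →
          ‖((U₀ x κ : 𝔸ˣ) : 𝔸) - 1‖ ≤ δ₀) →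
      ∀ φ : Site d → Fin d → 𝔸,
        IsLandau138 L 1 η (cubeFam false L a M ρ k 0) (cubeLamS L a M ρ k 1) U₀ φ →
        (∀ (y : Site d) (τ : Fin d), (∀ j, j ≤ 1 → ¬ SideTouches (cubeFam false L a M ρ k j) y τ) → φ y τ = 0) →
        ∀ N : ℝ, 0 ≤ N →
          (∀ j, j ≤ 1 → ∀ (y : Site d) (τ : Fin d), BondTouches (cubeFam false L a M ρ k j) y τ →
              ((L : ℝ) ^ j * η) ^ 3 * ‖Jcur η U₀ φ τ y‖ ≤ N) →
          (∀ j, j ≤ 1 → ∀ c ∈ cubeLamBP L a M ρ k 1 j, ‖linCovIter L U₀ (iEta η φ) j c.1 c.2‖ ≤ N) →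
          (∀ (y : Site d) (τ : Fin d), ¬ BondTouches (cubeFam false L a M ρ k 0) y τ → η * ‖φ y τ‖ ≤ N) →
          ∀ j, j ≤ 1 → ∀ (y : Site d) (τ : Fin d), SideTouches (cubeFam false L a M ρ k j) y τ →
            ((L : ℝ) ^ j * η) * ‖φ y τ‖ ≤ B' * N ∧
            (∀ ν : Fin d, ((L : ℝ) ^ j * η) ^ 2 * ‖covDerivFwd η U₀ ν (fun z => φ z τ) y‖ ≤ B' * N) ∧
            ((L : ℝ) ^ j * η) ^ 3 * ‖covLap η U₀ (fun z => φ z τ) y‖ ≤ B' * N := by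
  classical
  obtain ⟨δ₀, B', hδ₀, hB', H⟩ := exists_curved159_perCube_truncOne (𝔸 := 𝔸) hd2 hL hη a M ρ hk
  refine ⟨δ₀, B', hδ₀, hB', ?_⟩
  intro U₀ hU hδ φ hLan hs N hN h1 h2 h3 j hj y τ hst
  -- the box and the modified background
  obtain ⟨lo, hlo⟩ : ∃ lo : Site d, lo = sqLo L a ρ k 0 - ((L : ℤ) + 3) • (1 : Site d) := ⟨_, rfl⟩
  obtain ⟨hi, hhi⟩ : ∃ hi : Site d, hi = sqHi L a M ρ k 0 + ((L : ℤ) + 3) • (1 : Site d) := ⟨_, rfl⟩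
  have hlo_i : ∀ i, lo i = sqLo L a ρ k 0 i - (L + 3) := fun i => by
    rw [hlo]; simp only [Pi.sub_apply, Pi.smul_apply, Pi.one_apply, smul_eq_mul, mul_one]
  have hhi_i : ∀ i, hi i = sqHi L a M ρ k 0 i + (L + 3) := fun i => by
    rw [hhi]; simp only [Pi.add_apply, Pi.smul_apply, Pi.one_apply, smul_eq_mul, mul_one]
  obtain ⟨U₀', hU₀'⟩ : ∃ U₀' : Site d → Fin d → 𝔸ˣ, U₀' = fun x κ => if InBox lo hi x then U₀ x κ else 1 := ⟨_, rfl⟩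
  have hagree : ∀ (x : Site d) (κ : Fin d), InBox lo hi x → U₀' x κ = U₀ x κ := fun x κ hx => by
    rw [hU₀']; exact if_pos hx
  have hU' : ∀ x κ, U₀' x κ ∈ U1 𝔸 := by
    intro x κ; rw [hU₀']
    show (if InBox lo hi x then U₀ x κ else 1) ∈ U1 𝔸
    split_ifs
    · exact hU x κ
    · exact (U1 𝔸).one_mem
  have hδ' : ∀ x κ, ‖((U₀' x κ : 𝔸ˣ) : 𝔸) - 1‖ ≤ δ₀ := by
    intro x κ
    by_cases hx : InBox lo hi x
    · rw [hagree x κ hx]; rw [hlo, hhi] at hx; exact hδ x κ hx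
    · have : U₀' x κ = 1 := by rw [hU₀']; exact if_neg hx
      rw [this, Units.val_one, sub_self, norm_zero]; exact hδ₀.le
  -- geometric facts: `□₀ = [sqLo₀, sqHi₀]`, `□_j ⊆ □₀`
  have hΩ0 : cubeFam false L a M ρ k 0 = cube L a M ρ k 0 := cubeFam_false_zero L a M ρ k
  have hcubej : ∀ j', j' ≤ 1 → cubeFam false L a M ρ k j' ⊆ {x | InBox (sqLo L a ρ k 0) (sqHi L a M ρ k 0) x} := by
    intro j' hj'
    rw [cubeFam_false_of_le L a M ρ (hj'.trans hk)]
    exact cube_anti (Nat.zero_le j') (hj'.trans hk)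
  have hL1 : (1 : ℤ) ≤ L := by exact_mod_cast hL
  -- agreement on a ball around a point of `[sqLo₀ − 3, sqHi₀ + 2]`-type boxes: everything within `L + 3` of `□₀`
  have hball : ∀ (x : Site d) (r : ℤ), 0 ≤ r → (∀ i, sqLo L a ρ k 0 i - (L + 3) + r ≤ x i ∧ x i ≤ sqHi L a M ρ k 0 i + (L + 3) - r) →
      ∀ (y' : Site d) (κ : Fin d), (∀ i, x i - r ≤ y' i ∧ y' i ≤ x i + r) → U₀ y' κ = U₀' y' κ := by
    intro x r hr hx y' κ hy'
    refine (hagree y' κ fun i => ?_).symm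
    rw [hlo_i, hhi_i]
    have h1 := hx i; have h2 := hy' i
    constructor <;> linarith [h1.1, h1.2, h2.1, h2.2]
  -- (o) the Landau condition transfers (same multiplier): stencil on the radius-2 ball, transpose on the `L`-block, both inside the box for `x ∈ □₀`
  have hLan' : IsLandau138 L 1 η (cubeFam false L a M ρ k 0) (cubeLamS L a M ρ k 1) U₀' φ := by
    obtain ⟨μ, hμ⟩ := hLan
    refine ⟨μ, fun x hx => ?_⟩
    have hxb : InBox (sqLo L a ρ k 0) (sqHi L a M ρ k 0) x := by rw [hΩ0, mem_cube_zero_iff] at hx; exact hx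
    have e1 := landauStencil_congr_bg (η := η) (cubeFam false L a M ρ k 0) φ x
      (hball x 2 (by norm_num) (fun i => by have := hxb i; constructor <;> linarith [this.1, this.2]))
    have e2 : QT L 1 (cubeLamS L a M ρ k 1) U₀ μ x = QT L 1 (cubeLamS L a M ρ k 1) U₀' μ x := by
      refine QT_one_congr_bg hL _ μ x fun z κ hz _ => ?_
      exact hball x ((L : ℤ) - 1) (by linarith) (fun i => by have := hxb i; constructor <;> linarith [this.1, this.2]) z κ
        (fun i => by
          have := hz i
          simpa only [Pi.sub_apply, Pi.add_apply, Pi.smul_apply, Pi.one_apply, smul_eq_mul, mul_one] using this)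
    rw [← e1, ← e2]; exact hμ x hx
  -- (i) the current at the touching bonds
  have h1' : ∀ j, j ≤ 1 → ∀ (y : Site d) (τ : Fin d), BondTouches (cubeFam false L a M ρ k j) y τ →
      ((L : ℝ) ^ j * η) ^ 3 * ‖Jcur η U₀' φ τ y‖ ≤ N := by
    intro j' hj' y' τ' hbt
    have hyb : InBox (sqLo L a ρ k 0 - 1) (sqHi L a M ρ k 0) y' :=
      inBox_pred_of_bondTouches (hbt.imp (fun h => hcubej j' hj' h) (fun h => hcubej j' hj' h))
    have e := Jcur_congr_bg (η := η) φ τ' y'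
      (hball y' 1 (by norm_num) (fun i => by
        have := hyb i; simp only [Pi.sub_apply, Pi.one_apply] at this; constructor <;> linarith [this.1, this.2]))
    rw [← e]; exact h1 j' hj' y' τ' hbt
  -- (ii) the averages over print's class: the class bond's box lies in `□₀` (`j = 1`) or is the bond itself (`j = 0`)
  have h2' : ∀ j, j ≤ 1 → ∀ c ∈ cubeLamBP L a M ρ k 1 j, ‖linCovIter L U₀' (iEta η φ) j c.1 c.2‖ ≤ N := by
    intro j' hj' c hc
    have e : linCovIter L U₀ (iEta η φ) j' c.1 c.2 = linCovIter L U₀' (iEta η φ) j' c.1 c.2 := by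
      refine linCovIter_congr L hL j' c.1 c.2 (fun z κ hz _ => (hagree z κ ?_).symm) (fun _ _ _ _ => rfl)
      intro i
      rw [hlo_i, hhi_i]
      rcases Nat.lt_or_ge j' 1 with h0 | h1le
      · -- `j = 0`: the box is the bond `[c.1, c.1 + e]`, and the bond touches `□₀`
        have hj0 : j' = 0 := by omega
        subst hj0
        have hbt : BondTouches (cube L a M ρ k 0) c.1 c.2 := cubeLamBP_zero_bondTouches L a M ρ k 1 hc
        have hcb : InBox (sqLo L a ρ k 0 - 1) (sqHi L a M ρ k 0) c.1 := inBox_pred_of_bondTouches hbt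
        have h1 := hcb i; have h2 := hz i
        simp only [loK, bondHiK, pow_zero, one_mul, Pi.sub_apply, Pi.one_apply] at h1 h2
        constructor
        · linarith [h1.1, h2.1]
        · have : z i ≤ c.1 i + 1 := by have := h2.2; split_ifs at this <;> omega
          linarith [h1.2]
      · -- `j = 1`: the box lies in `□₀` (`cubeLamBP_box_subset_pred`)
        have hj1 : j' = 1 := le_antisymm hj' h1le
        subst hj1
        have hzc : z ∈ cube L a M ρ k (1 - 1) := cubeLamBP_box_subset_pred hL a M hρ (by norm_num) hk hc z hz
        rw [Nat.sub_self, mem_cube_zero_iff] at hzc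
        have := hzc i
        constructor <;> linarith [this.1, this.2]
    rw [← e]; exact h2 j' hj' c hc
  -- file (D) at the modified background
  obtain ⟨t1, t2, t3⟩ := H U₀' hU' hδ' φ hLan' hs N hN h1' h2' h3 j hj y τ hst
  -- the targets read back at `U₀`: `y` side-touches `□_j ⊆ □₀`, so `y ∈ [sqLo₀ − 2, sqHi₀ + 1]`
  have hyb : InBox (sqLo L a ρ k 0 - 2) (sqHi L a M ρ k 0 + 1) y :=
    inBox_widen_of_sideTouches (B8Eq140Level.sideTouches_mono (hcubej j hj) hst)
  have hyb' : ∀ i, sqLo L a ρ k 0 i - 2 ≤ y i ∧ y i ≤ sqHi L a M ρ k 0 i + 1 := fun i => by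
    have := hyb i; simp only [Pi.sub_apply, Pi.add_apply, Pi.ofNat_apply] at this
    exact ⟨by linarith [this.1], by linarith [this.2]⟩
  refine ⟨t1, fun ν => ?_, ?_⟩
  · have e : covDerivFwd η U₀ ν (fun z => φ z τ) y = covDerivFwd η U₀' ν (fun z => φ z τ) y :=
      covDerivFwd_congr_bg ν _ y (hball y 0 le_rfl (fun i => by have := hyb' i; constructor <;> linarith [this.1, this.2]) y ν
        (fun i => ⟨by linarith, by linarith⟩))
    rw [e]; exact t2 ν
  · have e : covLap η U₀ (fun z => φ z τ) y = covLap η U₀' (fun z => φ z τ) y :=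
      covLap_congr_bg _ y (hball y 1 (by norm_num) (fun i => by have := hyb' i; constructor <;> linarith [this.1, this.2]))
    rw [e]; exact t3

end Literature.MathematicalPhysics.QuantumFieldTheory.Balaban1983to89.B8Ineq159CurvedCubeMemberLocal

end
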